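import Literature.MathematicalPhysics.QuantumFieldTheory.Balaban1983to89.B9Thm312WholeFromThm310L2
import Literature.MathematicalPhysics.QuantumFieldTheory.Balaban1983to89.B9RWSums343HolderDir
import Literature.MathematicalPhysics.QuantumFieldTheory.Balaban1983to89.B9RWSums344InputPairGDir
import Literature.MathematicalPhysics.QuantumFieldTheory.Balaban1983to89.B9RWSums346MixedPairGDir
import Literature.MathematicalPhysics.QuantumFieldTheory.Balaban1983to89.B9RWSums346SecondDiffDir
import Literature.MathematicalPhysics.QuantumFieldTheory.Balaban1983to89.B9RWSums346TwoDir

/-!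
# `Balaban1983to89.B9Thm312WholeFromThm310R1A` — «THEOREM 3.3 FOR G₀» FROM THEOREM 3.10's SUM, OVER THE DIRECTION LETTERS (R1′-A):
# n06-l's `B9Thm312WholeFromThm310(L2)` Hölder ∕ input ∕ L² faces with `hi : Identities310₂` and the re-threaded G-side engines

T. Bałaban, *Propagators for lattice gauge theories in a background field*, Commun. Math. Phys. **99** (1985) 389–434
[`Balaban1985BackgroundPropagators`, "B9"], Thm 3.10 (3.105)–(3.108) pp. 414–416, Thm 3.3 p. 399, (3.42)–(3.46) pp. 397–398, (3.39)–(3.40) p. 397, p. 413,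
p. 421 (G₀ := G); T. Bałaban, *Propagators and renormalization transformations for lattice gauge theories. II*, Commun. Math. Phys. **96** (1984) 223–250
[`Balaban1984PropagatorsII`, "[4]"], (2.52)–(2.55) p. 232, Lemma 2.1 (2.60)–(2.61) p. 234.

statement-level skeleton of published theorems with citation tags; proofs where landed; nothing here is a claim about the
Yang–Mills mass gap

WHY THIS FILE (cell `pub-ymgap`, Track A node N06 [B9], rows 19–21; seat `pub-ymgap-dag-n06-c` g11; dag-n06-d g11's LOCATED-R1A, bus l.35122).  The
rows-20–21 G₀ layer of the certificate (`…N06G0LayerFromThm310AtPinsE.g0_layer_of_thm310_coreB`) feeds the rows-18–19 structure conjunct `hi` of `h36A`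
to n06-l's faces `B9Thm312WholeFromThm310.thm33G0Dir_of_conv3107` and `B9Thm312WholeFromThm310L2.thm33G0L2M_of_conv3107(_l4)`, which take v1
`hi : Identities310` and call n06-k's v1 engines.  Under the A-side re-thread R1′-A (LOCATED-9, bus l.32219: `Identities310.leibL` is not inhabitable at
def-Y's pins; the repaired conjunct is `B9Thm310WholeDir.Identities310₂ 𝔬' 𝔡 𝔩 R H U`, Laplacian-Leibniz per direction) those faces need ₂-TWINS calling
the re-threaded engines `B9RWSums343HolderDir.holder343_of_local310_dir`, `B9RWSums344InputPairGDir.inputPair3445_of_local310_dir`,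
`B9RWSums346SecondDiffDir.l2line3∕5_of_local310_dir`, `B9RWSums346MixedPairGDir.l2mixed_of_local310_dir`, `B9RWSums346TwoDir.l2line4_of_local310_dir`
(all in the tree).  THIS FILE: `thm33G0Dir_of_conv3107₂`, `thm33G0L2M_of_conv3107_l4₂`, `thm33G0L2M_of_conv3107₂` — TYPE-ONLY swaps (`hi`'s type, the
extra letter family `𝔩 : DirLetters310 𝔬' P` after `𝔡`, engine names); statements, constants, rates and proofs otherwise VERBATIM (n06-l's private
nonnegativity helpers copied, private there).  The sup faces of `B9Thm312WholeFromThm310` §1 (`thm33G0_of_conv3107`, `leftStep_of_conv3107`,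
`thm33G0DirR_of_conv3107`) do not read `hi` and need no twin.

HONEST SCOPE.  Kernel bookkeeping over landed modules: NOTHING of print asserted, NO new hypothesis species.  COUNT-NEUTRAL; N06 NOT discharged; one finite
lattice at a time; nothing continuum, nothing about OS positivity or the mass gap.
-/

namespace Literature.MathematicalPhysics.QuantumFieldTheory.Balaban1983to89.B9Thm312WholeFromThm310R1A

open Literature.MathematicalPhysics.QuantumFieldTheory.Balaban1983to89
open Finset B6RandomWalk B6RandomWalkHom B9Thm34Ext B11SectG B9Thm37Glue B9SectDL2Decay B9Ineq347
open B9Thm312Whole B9Thm312WholeLeft B9Thm312WholeClasses B9Thm312WholeBlocksNbr B9Thm312WholeDir B9Thm313WholeDir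
open B9Thm310Whole B9RWSums343Holder B9RWSums343to347Whole B9RWSums346Schur B9RWSums346Two B9RWSums346MixedPair
open B9RWSums344Input B9RWSums344InputPair B9RWSums346SecondDiff B9Thm312WholeFromThm310 B9Thm312WholeFromThm310L2
open B9Thm37WholeDir B9Thm310WholeDir B9RWSums343HolderDir B9RWSums344InputPairGDir B9RWSums346MixedPairGDir B9RWSums346SecondDiffDir
open B9RWSums346TwoDir

noncomputable section

variable {g : B9.Geometry} {B : B9.Backgrounds} {X Y Z W ι A PX PY P : Type} [Fintype g.Site] [Fintype P]
variable {R : ℝ} {H : Prop}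

/-! ## §0 n06-l's private weakenings and nonnegativity helpers (copied; private in the v1 files) -/


/-- Weakening the rate of a decaying majorant: C·w·e^{−δd} ≦ C·w·e^{−ρd} for ρ ≦ δ, d ≧ 0, C·w ≧ 0. [folklore] -/
private theorem mul_exp_le_of_rate_le {C δ ρ d : ℝ} (hC : 0 ≤ C) (hρ : ρ ≤ δ) (hd : 0 ≤ d) :
    C * Real.exp (-(δ * d)) ≤ C * Real.exp (-(ρ * d)) :=
  mul_le_mul_of_nonneg_left (Real.exp_le_exp.mpr (neg_le_neg (mul_le_mul_of_nonneg_right hρ hd))) hC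

/-- n06-k's Hölder constant `holderConst` is ≧ 0 for nonnegative letters (its own nonnegativity lemma is private). [folklore] -/
private theorem holderConst_nonneg' {d : ℕ} {δ₀ α NH NF C b t : ℝ} (hNH : 0 ≤ NH) (hNF : 0 ≤ NF) (hC : 0 ≤ C) (hb : 0 ≤ b)
    (ht : 0 ≤ t) : 0 ≤ holderConst d δ₀ α NH NF C b t := by
  have hc1 : 0 ≤ B6.c1 d δ₀ α := c1_nonneg d δ₀ α
  unfold holderConst
  have h1 : 0 ≤ 2 * NH * b * B6.c1 d δ₀ α := mul_nonneg (mul_nonneg (mul_nonneg (by norm_num) hNH) hb) hc1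
  have h2 : 0 ≤ NH * b := mul_nonneg hNH hb
  have h3 : 0 ≤ NF * t * C * B6.c1 d δ₀ α := mul_nonneg (mul_nonneg (mul_nonneg hNF ht) hC) hc1
  linarith

/-- n06-k's (3.44) constant `inputConst44` is ≧ 0 for nonnegative letters. [folklore] -/
private theorem inputConst44_nonneg' {d₁ : ℕ} {δ₁ α₁ NI NF C L₀ b t : ℝ} (hNI : 0 ≤ NI) (hNF : 0 ≤ NF) (hC : 0 ≤ C)
    (hL₀ : 0 ≤ L₀) (hb : 0 ≤ b) (ht : 0 ≤ t) : 0 ≤ inputConst44 d₁ δ₁ α₁ NI NF C L₀ b t := by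
  have hc1 : 0 ≤ B6.c1 d₁ δ₁ α₁ := c1_nonneg d₁ δ₁ α₁
  unfold inputConst44
  exact add_nonneg (mul_nonneg hNI hb) (mul_nonneg (mul_nonneg (mul_nonneg hC (mul_nonneg hNF ht)) hL₀) hc1)

/-- n06-k's (3.45) constant `inputConst45` is ≧ 0 for nonnegative letters. [folklore] -/
private theorem inputConst45_nonneg' {d₁ : ℕ} {δ₁ α₁ NI NF L₀ hc b t : ℝ} (hNI : 0 ≤ NI) (hNF : 0 ≤ NF) (hL₀ : 0 ≤ L₀)
    (hhc : 0 ≤ hc) (hb : 0 ≤ b) (ht : 0 ≤ t) : 0 ≤ inputConst45 d₁ δ₁ α₁ NI NF L₀ hc b t := by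
  have hc1 : 0 ≤ B6.c1 d₁ δ₁ α₁ := c1_nonneg d₁ δ₁ α₁
  unfold inputConst45
  exact add_nonneg (mul_nonneg hNI hb) (mul_nonneg (mul_nonneg (mul_nonneg hhc (mul_nonneg hNF ht)) hL₀) hc1)

/-! ## §1 The sup members: `Thm33G0`, `LeftStep`, `Thm33G0DirR` from `Conv3107` -/


/-- n06-k's two-sided L² constant `twoConst` is ≧ 0 for nonnegative letters. [folklore] -/
private theorem twoConst_nonneg' {d₁ : ℕ} {δ₁ α₁ N2 B2 NF θ2 C L₀ : ℝ} (hN2 : 0 ≤ N2) (hB2 : 0 ≤ B2) (hNF : 0 ≤ NF) (hθ2 : 0 ≤ θ2)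
    (hC : 0 ≤ C) (hL₀ : 0 ≤ L₀) : 0 ≤ twoConst d₁ δ₁ α₁ N2 B2 NF θ2 C L₀ := by
  have := c1_nonneg d₁ δ₁ α₁
  unfold twoConst
  positivity

/-! ## §1 The Hölder probes, the direction-indexed entries and the input members over the direction letters: `Thm33G0Dir` -/

section Holder

variable [DecidableEq g.Site] [Fintype X] [DecidableEq X] [Fintype Y] [DecidableEq Y] [Fintype ι] [Fintype A]
variable [Fintype PX] [DecidableEq PX] [Fintype PY] [DecidableEq PY]

/-- ★★ **THEOREM 3.3 FOR G₀ := G(U) IN THE HÖLDER AND INPUT CLASSES, DIRECTION-INDEXED, OVER THE DIRECTION LETTERS (R1′-A)** — n06-l's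
`thm33G0Dir_of_conv3107` VERBATIM with `hi : Identities310₂ 𝔬' 𝔡 𝔩 R H U` and the re-threaded engines `holder343_of_local310_dir` ∕
`inputPair3445_of_local310_dir`: the rows-20–21 schema
`Thm33G0Dir 𝔬 𝔭 Dd Dsd R H bHX C B_h B_i B_i2 ρ U` from the rows-18–19 material: the (3.43) probe members `h43L ∕ h43R` by n06-k's
`holder343_of_local310` (legs `HolderLegs310`, factors `FactorsHolder310`, the fixed point (3.106) via `Identities310`, the smallness
N_F·θ₀M⁻¹·c₁ ≦ ½, the right sup entry of `Conv3107`); the per-direction left entry `e1d` by `DirSup310.left`; its probe `h43d` by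
`DirSupHolder310.probe`; the input members `h44m ∕ h45m` by n06-k's `inputPair3445_of_local310` (legs `InputLegsPair310`, factors
`FactorsInputPair310`, member facts `Facts347` for p. 398's scale transfer).  Constants: B_h(β) = `holderConst d₁ δ₀ α₁ NH NF C (Bl β) (θH β)`,
B_i(ε) = `inputConst44 d₁ δ₀ α₁ NI NF C L₀ (BI ε) (θI ε)`, B_i2(ε, β) = `inputConst45 d₁ δ₀ α₁ NI NF L₀ (B_h β) (BI2 ε β) (θI (β + ε))`; one
common rate ρ ≦ (1 − α)δ (δ = the rate of `Conv3107`, δ ≦ (1 − α₁)δ₀ with δ₀ the legs' rate; α = the transfer exponent of `Facts347`).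
Nothing of print asserted. [cite: Balaban1985BackgroundPropagators, Thm 3.10 (3.105)–(3.108) pp.414–416 + Thm 3.3 p.399 + (3.42)–(3.45) pp.397–398 + (3.39)–(3.40) p.397 + p.413; Balaban1984PropagatorsII, (2.52)–(2.55) p.232 + Lemma 2.1 p.234] -/
theorem thm33G0Dir_of_conv3107₂ (𝔬 : B9Thm312Whole.Ops g B X Y Z W) (𝔬' : Ops310 g B X Y ι A) (𝔡 : DirOps310 𝔬' P)
    (𝔩 : DirLetters310 𝔬' P)
    (𝔭 : HolderProbes g B X Y PX PY) (bHX : ℝ → BlockNorm (toB6 g R H) (X → ℝ))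
    (d d₁ : ℕ) (δ α L₀ δ₀ α₁ ρ' N N' NF Cℓ θ₀ NH NI C ρ : ℝ) (κ : Sizes310)
    (SH SI : ι → Finset g.Site) (Bl θH BI θI : ℝ → ℝ) (BI2 : ℝ → ℝ → ℝ) (U : B.Cfg)
    -- the letter identifications (G₀ := G; at def-Y's pins both records read the same coordinate models)
    (hblk : 𝔬.blk = 𝔬'.blk) (hblkY : 𝔬.blkY = 𝔬'.blkY) (hG0 : 𝔬.G0 U = 𝔬'.G U) (hD : 𝔬.D U = 𝔬'.D U)
    (hDs : 𝔬.Dstar U = 𝔬'.Dstar U)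
    -- numerics
    (hδ₀ : 0 ≤ δ₀) (hα₁ : 0 ≤ α₁) (hα₁1 : α₁ ≤ 1) (hNF : 0 ≤ NF) (hθ₀ : 0 ≤ θ₀) (hNH : 0 ≤ NH) (hNI : 0 ≤ NI)
    (hM : 1 ≤ g.M) (hC : 0 ≤ C) (hδ : 0 ≤ δ) (hδle : δ ≤ (1 - α₁) * δ₀) (hαδ : 0 ≤ α * δ) (hαδ1 : α * δ ≤ δ)
    (hρ : ρ ≤ (1 - α) * δ)
    (hBl : ∀ β, 0 ≤ β → β < 1 → 0 ≤ Bl β) (hθH : ∀ β, 0 ≤ β → β < 1 → 0 ≤ θH β)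
    (hBI : ∀ ε, 0 < ε → ε ≤ 1 → 0 ≤ BI ε) (hBI2 : ∀ ε β, 0 < ε → ε ≤ 1 → 0 ≤ β → β < 1 → 0 ≤ BI2 ε β)
    (hθI : ∀ ε, 0 < ε → 0 ≤ θI ε)
    -- the member's static data ([4] (2.46), (2.54), Lemma 2.1; the member facts of p. 398's transfer)
    (hs : StaticOK310 𝔬' ρ' N N' NF Cℓ κ)
    (hcntH : ∀ a : g.Site, (∑ i, if a ∈ SH i then (1 : ℝ) else 0) ≤ NH)
    (hcntI : ∀ a : g.Site, (∑ i, if a ∈ SI i then (1 : ℝ) else 0) ≤ NI)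
    (h261 : Ineq261 d₁ (toB6 g R H) δ₀ α₁) (hq : NF * (θ₀ * g.M⁻¹) * B6.c1 d₁ δ₀ α₁ ≤ 1 / 2)
    (hF : Facts347 g R H d δ α L₀)
    -- rows 18–19's Theorem-3.10 schemas at U (n06-k) and the sum's (3.42) majorants
    (hf : Factors389 𝔬' R H θ₀ δ₀ U) (hi : Identities310₂ 𝔬' 𝔡 𝔩 R H U)
    (hL : HolderLegs310 𝔬' 𝔭 R H SH Bl δ₀ U) (hFH : FactorsHolder310 𝔬' 𝔭 R H θH δ₀ U)
    (hIL : InputLegsPair310 𝔬' 𝔡 𝔭 R H bHX SI BI BI2 δ₀ U) (hFI : FactorsInputPair310 𝔬' 𝔡 R H bHX θI δ₀ U)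
    (hDS : DirSup310 𝔬' 𝔡 R H U) (hDH : DirSupHolder310 𝔬' 𝔡 𝔭 R H U) (hc : Conv3107 𝔬' R H C δ U) :
    Thm33G0Dir 𝔬 𝔭 𝔡.Dd 𝔡.Dsd R H bHX C (fun β => holderConst d₁ δ₀ α₁ NH NF C (Bl β) (θH β))
      (fun ε => inputConst44 d₁ δ₀ α₁ NI NF C L₀ (BI ε) (θI ε))
      (fun ε β => inputConst45 d₁ δ₀ α₁ NI NF L₀ (holderConst d₁ δ₀ α₁ NH NF C (Bl β) (θH β)) (BI2 ε β) (θI (β + ε))) ρ U := by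
  have hlen : ∀ y : g.Site, 0 ≤ g.len y := fun y => (hs.lenpos y).le
  have hL₀ : 0 ≤ L₀ := le_trans (le_trans zero_le_one hF.one_le_L) hF.L_le
  have hρδ : ρ ≤ δ := le_trans hρ (by nlinarith [hαδ])
  have hρ1 : ρ ≤ (1 - α) * δ := hρ
  -- n06-k's (3.43) probe majorants of the sum, at the rate δ of `Conv3107`
  have hHol := holder343_of_local310_dir 𝔬' 𝔡 𝔩 𝔭 R H d₁ δ₀ α₁ ρ' N N' NF Cℓ θ₀ NH C δ κ SH Bl θH U hδ₀ hα₁ hα₁1 hNF hθ₀ hNH hM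
    hC hδ hδle hs hcntH hBl hθH h261 hq hf hi hL hFH hc.2.2.1
  -- n06-k's (3.44)∕(3.45) members of the sum per direction pair, at the rate (1 − α)δ
  have hInp := fun (ν μ : P) => inputPair3445_of_local310_dir 𝔬' 𝔡 𝔩 𝔭 R H bHX d d₁ δ α L₀ δ₀ α₁ ρ' N N' NF Cℓ NI C κ SI
    (fun β => holderConst d₁ δ₀ α₁ NH NF C (Bl β) (θH β)) BI θI BI2 U hδ₀ hα₁ hNF hNI hM hC hδle hαδ hαδ1 hs hcntI
    (fun β hβ0 hβ1 => holderConst_nonneg' hNH hNF hC (hBl β hβ0 hβ1) (hθH β hβ0 hβ1)) hBI hBI2 hθI h261 hF hi hIL hFI hDS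
    hDH hc.2.1 (fun β hβ0 hβ1 => (hHol β hβ0 hβ1).1) ν μ
  have hwk : ∀ (β : ℝ), 0 ≤ β → β < 1 → ∀ a b : g.Site,
      holderConst d₁ δ₀ α₁ NH NF C (Bl β) (θH β) * g.len a ^ (1 - β) * Real.exp (-(δ * g.dist a b)) ≤
        holderConst d₁ δ₀ α₁ NH NF C (Bl β) (θH β) * g.len a ^ (1 - β) * Real.exp (-(ρ * g.dist a b)) :=
    fun β hβ0 hβ1 a b => mul_exp_le_of_rate_le
      (mul_nonneg (holderConst_nonneg' hNH hNF hC (hBl β hβ0 hβ1) (hθH β hβ0 hβ1)) (Real.rpow_nonneg (hlen a) _)) hρδ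
      (hs.dnn a b)
  have hwk1 : ∀ a b : g.Site, C * g.len a * Real.exp (-(δ * g.dist a b)) ≤ C * g.len a * Real.exp (-(ρ * g.dist a b)) :=
    fun a b => mul_exp_le_of_rate_le (mul_nonneg hC (hlen a)) hρδ (hs.dnn a b)
  refine
    { h43L := fun β hβ0 hβ1 => ?_
      h43R := fun β hβ0 hβ1 => ?_
      e1d := fun ν => ?_
      h43d := fun ν β hβ0 hβ1 => ?_
      h44m := fun q ε hε hε1 => ?_
      h45m := fun q ε β hε hε1 hβ0 hβ1 => ?_ }
  · -- Φ^Y_β ∘ ∇_U ∘ G₀ (reassociated by definitional unfolding)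
    rw [hblk, hG0, hD]
    have h : HasMajorantHom (g := toB6 g R H) 𝔬'.blk 𝔭.blkPY (𝔭.ΦY U β ∘ₗ (𝔬'.D U ∘ₗ 𝔬'.G U))
        (fun (a b : g.Site) => holderConst d₁ δ₀ α₁ NH NF C (Bl β) (θH β) * g.len a ^ (1 - β) *
          Real.exp (-(δ * g.dist a b))) := (hHol β hβ0 hβ1).1
    exact hasMajorantHom_mono (g := toB6 g R H) _ _ h (hwk β hβ0 hβ1)
  · rw [hblkY, hG0, hDs]
    exact hasMajorantHom_mono (g := toB6 g R H) _ _ (hHol β hβ0 hβ1).2 (hwk β hβ0 hβ1)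
  · rw [hblk, hG0]
    exact hasMajorantHom_mono (g := toB6 g R H) _ _ (hDS.left _ hc.2.1 ν) hwk1
  · rw [hblk, hG0]
    have h : HasMajorantHom (g := toB6 g R H) 𝔬'.blk 𝔭.blkPX (𝔭.ΦX U β ∘ₗ (𝔡.Dd U ν ∘ₗ 𝔬'.G U))
        (fun (a b : g.Site) => holderConst d₁ δ₀ α₁ NH NF C (Bl β) (θH β) * g.len a ^ (1 - β) *
          Real.exp (-(δ * g.dist a b))) := hDH.probe β _ (hHol β hβ0 hβ1).1 ν
    exact hasMajorantHom_mono (g := toB6 g R H) _ _ h (hwk β hβ0 hβ1)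
  · rw [hblk, hG0]
    exact ((hInp q.1 q.2).1 ε hε hε1).mono fun a b => mul_exp_le_of_rate_le
      (inputConst44_nonneg' hNI hNF hC hL₀ (hBI ε hε hε1) (hθI ε hε)) hρ1 (hs.dnn a b)
  · rw [hG0]
    have hK : 0 ≤ inputConst45 d₁ δ₀ α₁ NI NF L₀ (holderConst d₁ δ₀ α₁ NH NF C (Bl β) (θH β)) (BI2 ε β) (θI (β + ε)) :=
      inputConst45_nonneg' hNI hNF hL₀ (holderConst_nonneg' hNH hNF hC (hBl β hβ0 hβ1) (hθH β hβ0 hβ1))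
        (hBI2 ε β hε hε1 hβ0 hβ1) (hθI (β + ε) (by linarith))
    exact ((hInp q.1 q.2).2 ε β hε hε1 hβ0 hβ1).mono fun a b => by
      have h := mul_exp_le_of_rate_le (δ := (1 - α) * δ) (ρ := ρ) (mul_nonneg hK (Real.rpow_nonneg (hlen a) (-β)))
        hρ1 (hs.dnn a b)
      simpa only [mul_assoc] using h

end Holder

/-! ## §2 The rows-20–21 L² schema over the direction letters: `Thm33G0L2M` -/

section Assemble

variable [DecidableEq g.Site] [Fintype X] [DecidableEq X] [Fintype Y] [DecidableEq Y] [Fintype ι] [Fintype A]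

omit [DecidableEq Y] in
/-- ★★ **THEOREM 3.3 (3.46) FOR G₀ := G(U), THE ROWS-20–21 SCHEMA `Thm33G0L2M`, WITH THE BUNDLED TWO-SIDED LINE SUPPLIED, OVER THE DIRECTION
LETTERS (R1′-A)** — n06-l's `thm33G0L2M_of_conv3107_l4` VERBATIM with `hi : Identities310₂ 𝔬' 𝔡 𝔩 R H U` and the re-threaded engines
`l2line3∕5_of_local310_dir` ∕ `l2mixed_of_local310_dir`: from `Conv3107`
(the sum's (3.42) sup majorants at (C, δ)), the symmetry of G(U) and the transposes (∇_UG)ᵀ = G∇\*_U, (∇_{U,μ})ᵀ = ∇\*_{U,μ}, p. 398's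
transfer (`Facts347` at (δ, α)), and n06-k's per-pair L² lines of the sum (`l2line3∕5_of_local310`: legs `L2SecondLegs310` + factors
`FactorsL2Second310`; `l2mixed_of_local310`: `L2MixedLegs310` + `FactorsL2Mixed310` + `DirSup310`; the fixed point (3.106) via
`Identities310`; [4] Lemma 2.1 at the legs' rate δ₀); the bundled line ∇_UG₀∇\*_U is the hypothesis `hl4` (constant B₄, rate (1 − 2α)δ).
Output: one constant B₂ ≧ C·L₀, secondConst·L₀, mixedConst, B₄ and one rate ρ ≦ (1 − 3α)δ.  Nothing of print asserted.
[cite: Balaban1985BackgroundPropagators, Thm 3.10 (3.105)–(3.108) pp.414–416 + Thm 3.3 p.399 + (3.46) p.398 + (3.42) p.397 + (3.39) p.397 + p.398 remark after (3.47) + p.413 + p.391; Balaban1984PropagatorsII, (2.52)–(2.55) p.232 + Lemma 2.1 p.234] -/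
theorem thm33G0L2M_of_conv3107_l4₂ (𝔬 : B9Thm312Whole.Ops g B X Y Z W) (𝔬' : Ops310 g B X Y ι A) (𝔡 : DirOps310 𝔬' P)
    (𝔩 : DirLetters310 𝔬' P)
    (d d₁ : ℕ) (δ α L₀ δ₀ α₁ ρ' N N' NF Cℓ N3 B3 θ3 NM BM θM C B₄ B₂ ρ : ℝ) (κ : Sizes310)
    (S3 SM : ι → Finset g.Site) (U : B.Cfg)
    -- the letter identifications (G₀ := G)
    (hblk : 𝔬.blk = 𝔬'.blk) (hblkY : 𝔬.blkY = 𝔬'.blkY) (hG0 : 𝔬.G0 U = 𝔬'.G U) (hD : 𝔬.D U = 𝔬'.D U)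
    (hDs : 𝔬.Dstar U = 𝔬'.Dstar U)
    -- numerics
    (hNF : 0 ≤ NF) (hN3 : 0 ≤ N3) (hB3 : 0 ≤ B3) (hθ3 : 0 ≤ θ3) (hNM : 0 ≤ NM) (hBM : 0 ≤ BM) (hθM : 0 ≤ θM)
    (hM : 1 ≤ g.M) (hC : 0 ≤ C) (hαδ : 0 ≤ α * δ) (hα2 : 2 * α * δ ≤ δ) (hα₁δ₀ : 0 ≤ α₁ * δ₀)
    (hrate : (1 - 2 * α) * δ ≤ (1 - α₁) * δ₀) (hB₄ : 0 ≤ B₄)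
    (hB1 : C * L₀ ≤ B₂) (hB3' : secondConst d₁ δ₀ α₁ N3 B3 NF θ3 C L₀ * L₀ ≤ B₂)
    (hBM' : mixedConst d₁ δ₀ α₁ NM BM NF θM C L₀ ≤ B₂) (hB4' : B₄ ≤ B₂) (hρ : ρ ≤ (1 - 3 * α) * δ)
    -- static data, member facts, Lemma 2.1
    (hs : StaticOK310 𝔬' ρ' N N' NF Cℓ κ)
    (hcnt3 : ∀ a : g.Site, (∑ i, if a ∈ S3 i then (1 : ℝ) else 0) ≤ N3)
    (hcntM : ∀ a : g.Site, (∑ i, if a ∈ SM i then (1 : ℝ) else 0) ≤ NM)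
    (h261 : Ineq261 d₁ (toB6 g R H) δ₀ α₁) (hF : Facts347 g R H d δ α L₀)
    -- rows 18–19's Theorem-3.10 schemas at U (n06-k), the symmetry ∕ transposition letters, the sum's (3.42) majorants
    (hi : Identities310₂ 𝔬' 𝔡 𝔩 R H U)
    (hL3 : L2SecondLegs310 𝔬' 𝔡 R H S3 B3 δ₀ U) (hF3 : FactorsL2Second310 𝔬' 𝔡 R H θ3 δ₀ U)
    (hLM : L2MixedLegs310 𝔬' 𝔡 R H SM BM δ₀ U) (hFM : FactorsL2Mixed310 𝔬' 𝔡 R H θM δ₀ U)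
    (hDS : DirSup310 𝔬' 𝔡 R H U) (hDT : DirTranspose310 𝔬' 𝔡 U)
    (hsym : IsTransposePair (𝔬'.G U) (𝔬'.G U)) (htr : IsTransposePair (𝔬'.D U ∘ₗ 𝔬'.G U) (𝔬'.G U ∘ₗ 𝔬'.Dstar U))
    (hc : Conv3107 𝔬' R H C δ U)
    (hl4 : BlockBd (g := toB6 g R H) 𝔬'.blkY 𝔬'.blkY (𝔬'.D U ∘ₗ (𝔬'.G U ∘ₗ 𝔬'.Dstar U))
      (fun (y y' : g.Site) => B₄ * Real.exp (-((1 - 2 * α) * δ * g.dist y y')))) :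
    Thm33G0L2M 𝔬 𝔡.Dd 𝔡.Dsd R H B₂ ρ U := by
  have hlen0 : ∀ y : g.Site, 0 ≤ g.len y := fun y => (hs.lenpos y).le
  have hL₀ : 0 ≤ L₀ := le_trans (le_trans zero_le_one hF.one_le_L) hF.L_le
  have hL₀1 : 1 ≤ L₀ := le_trans hF.one_le_L hF.L_le
  have hCB : C ≤ B₂ := le_trans (by nlinarith [hL₀1, hC]) hB1
  have hB₂ : 0 ≤ B₂ := le_trans hC hCB
  have hCL : 0 ≤ C * L₀ := mul_nonneg hC hL₀
  -- the rates: δ ≥ (1−α)δ ≥ (1−2α)δ ≥ (1−3α)δ ≥ ρ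
  have hρ0 : ρ ≤ δ := by nlinarith [hρ, hαδ]
  have hρ1 : ρ ≤ (1 - α) * δ := by nlinarith [hρ, hαδ]
  have hρ2 : ρ ≤ (1 - 2 * α) * δ := by nlinarith [hρ, hαδ]
  have hρ3 : ρ ≤ (1 - 2 * α) * δ - α * δ := by nlinarith [hρ, hαδ]
  have hexp : ∀ {r : ℝ}, ρ ≤ r → ∀ y y' : g.Site, Real.exp (-(r * g.dist y y')) ≤ Real.exp (-(ρ * g.dist y y')) :=
    fun hr y y' => Real.exp_le_exp.mpr (neg_le_neg (mul_le_mul_of_nonneg_right hr (hs.dnn y y')))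
  -- the generic weakening (c ≤ B₂, w ≥ 0, r ≥ ρ)
  have hweak : ∀ {c r : ℝ} (w : ℝ), 0 ≤ w → 0 ≤ c → c ≤ B₂ → ρ ≤ r → ∀ y y' : g.Site,
      c * w * Real.exp (-(r * g.dist y y')) ≤ B₂ * w * Real.exp (-(ρ * g.dist y y')) :=
    fun w hw hc0 hcB hr y y' => mul_le_mul (mul_le_mul_of_nonneg_right hcB hw) (hexp hr y y') (Real.exp_nonneg _)
      (mul_nonneg hB₂ hw)
  -- the per-direction transposes (∇_νG)ᵀ = G∇*_ν
  have htrd : ∀ ν : P, IsTransposePair (𝔡.Dd U ν ∘ₗ 𝔬'.G U) (𝔬'.G U ∘ₗ 𝔡.Dsd U ν) := fun ν => hsym.comp (hDT.tr ν).symm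
  -- n06-k's lines of the sum
  have hS0 := const_le_ratio_transfer hF hs.lenpos
    (S := secondConst d₁ δ₀ α₁ N3 B3 NF θ3 C L₀) (r := (1 - 2 * α) * δ) (secondConst_nonneg hN3 hB3 hNF hθ3 hC hL₀)
  have hS0' := const_le_ratio_transfer' hF hs.lenpos hs.symm
    (S := secondConst d₁ δ₀ α₁ N3 B3 NF θ3 C L₀) (r := (1 - 2 * α) * δ) (secondConst_nonneg hN3 hB3 hNF hθ3 hC hL₀)
  have hSK : 0 ≤ secondConst d₁ δ₀ α₁ N3 B3 NF θ3 C L₀ * L₀ := mul_nonneg (secondConst_nonneg hN3 hB3 hNF hθ3 hC hL₀) hL₀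
  refine
    { l0 := ?_
      l1 := ?_
      l2 := ?_
      l3 := fun q => ?_
      l4 := ?_
      l5 := fun q => ?_
      l1d := fun ν => ?_
      l2d := fun μ => ?_
      l4m := fun q => ?_ }
  · -- line 0: Schur, no transfer (rate δ)
    rw [hblk, hG0]
    refine (blockBd_l0_of_sup (R := R) (H := H) hC hs.symm hlen0 𝔬'.blk hc.1 hsym).mono fun y y' => ?_
    have h := hweak (g.len y * g.len y') (mul_nonneg (hlen0 y) (hlen0 y')) hC hCB hρ0 y y'
    calc C * g.len y * g.len y' * Real.exp (-(δ * g.dist y y'))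
        = C * (g.len y * g.len y') * Real.exp (-(δ * g.dist y y')) := by ring
      _ ≤ B₂ * (g.len y * g.len y') * Real.exp (-(ρ * g.dist y y')) := h
      _ = B₂ * g.len y * g.len y' * Real.exp (-(ρ * g.dist y y')) := by ring
  · -- line 1: ∇_UG₀ at the input scale
    rw [hblk, hblkY, hG0, hD]
    exact (blockBd_l1_of_sup hF hC hs.symm hs.lenpos 𝔬'.blk 𝔬'.blkY hc.2.1 hc.2.2.1 htr).mono fun y y' =>
      hweak (g.len y') (hlen0 y') hCL hB1 hρ1 y y'
  · -- line 2: G₀∇*_U at the output scale (n06-k's `blockBd_entry2` verbatim)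
    rw [hblk, hblkY, hG0, hDs]
    exact (blockBd_entry2 hF hC hs.symm hs.lenpos 𝔬'.blk 𝔬'.blkY hc.2.1 hc.2.2.1 htr).mono fun y y' =>
      hweak (g.len y) (hlen0 y) hCL hB1 hρ1 y y'
  · -- line 3: ∇_ν∇_μG₀ per pair, n06-k's line + the transfer at the swapped pair
    rw [hblk, hG0]
    have h3 := l2line3_of_local310_dir 𝔬' 𝔡 𝔩 R H d d₁ δ α L₀ δ₀ α₁ ρ' N N' NF Cℓ N3 B3 θ3 C κ S3 U hNF hN3 hB3 hθ3 hM hC hα2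
      hα₁δ₀ hrate hs hcnt3 h261 hF hi hL3 hF3 hDT hc.1 hsym q.1 q.2
    refine h3.mono fun y y' => (hS0' y y').trans ?_
    exact hweak ((g.len y)⁻¹ * g.len y') (mul_nonneg (inv_nonneg.mpr (hlen0 y)) (hlen0 y')) hSK hB3' hρ3 y y'
  · -- line 4 (bundled): supplied
    rw [hblkY, hG0, hD, hDs]
    refine hl4.mono fun y y' => ?_
    have h := hweak 1 zero_le_one hB₄ hB4' hρ2 y y'
    simpa only [mul_one] using h
  · -- line 5: G₀∇*_ν∇*_μ per pair, n06-k's line + the transfer at the direct pair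
    rw [hblk, hG0]
    have h5 := l2line5_of_local310_dir 𝔬' 𝔡 𝔩 R H d d₁ δ α L₀ δ₀ α₁ ρ' N N' NF Cℓ N3 B3 θ3 C κ S3 U hNF hN3 hB3 hθ3 hM hC hα2
      hα₁δ₀ hrate hs hcnt3 h261 hF hi hL3 hF3 hc.1 hsym q.1 q.2
    refine h5.mono fun y y' => (hS0 y y').trans ?_
    exact hweak (g.len y * (g.len y')⁻¹) (mul_nonneg (hlen0 y) (inv_nonneg.mpr (hlen0 y'))) hSK hB3' hρ3 y y'
  · -- ∇_{U,ν}G₀ at the input scale: Schur on the components (`DirSup310`) + adjoint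
    rw [hblk, hG0]
    exact (blockBd_l1_of_sup hF hC hs.symm hs.lenpos 𝔬'.blk 𝔬'.blk (hDS.left _ hc.2.1 ν) (hDS.right _ hc.2.2.1 ν)
      (htrd ν)).mono fun y y' => hweak (g.len y') (hlen0 y') hCL hB1 hρ1 y y'
  · -- G₀∇*_{U,μ} at the output scale
    rw [hblk, hG0]
    exact (blockBd_entry2 hF hC hs.symm hs.lenpos 𝔬'.blk 𝔬'.blk (hDS.left _ hc.2.1 μ) (hDS.right _ hc.2.2.1 μ)
      (htrd μ)).mono fun y y' => hweak (g.len y) (hlen0 y) hCL hB1 hρ1 y y'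
  · -- the mixed pair line (n06-k's `l2mixed_of_local310` verbatim)
    rw [hblk, hG0]
    have hm := l2mixed_of_local310_dir 𝔬' 𝔡 𝔩 R H d d₁ δ α L₀ δ₀ α₁ ρ' N N' NF Cℓ NM BM θM C κ SM U hNF hNM hBM hθM hM hC hα2
      hα₁δ₀ hrate hs hcntM h261 hF hi hLM hFM hDS hDT hc.2.1 hc.2.2.1 hsym q.1 q.2
    refine hm.mono fun y y' => ?_
    have h := hweak 1 zero_le_one (mixedConst_nonneg hNM hBM hNF hθM hC hL₀) hBM' hρ2 y y'
    simpa only [mul_one] using h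

/-- ★★ **THE SAME WITH THE BUNDLED TWO-SIDED LINE FROM n06-k's ONE-SLOT LEGS, OVER THE DIRECTION LETTERS (R1′-A)** — n06-l's
`thm33G0L2M_of_conv3107` VERBATIM with `hi : Identities310₂ …` and `B9RWSums346TwoDir.l2line4_of_local310_dir` (`B9RWSums346Two.L2TwoLegs310 ∕ FactorsL2_310`, an EXISTING
schema species of rows 18–19's lineage, via `l2line4_of_local310`; constant `twoConst`): `Thm33G0L2M 𝔬 Dd Dsd R H B₂ ρ U` with no L² line
of G₀ displayed at all. [cite: Balaban1985BackgroundPropagators, Thm 3.10 (3.105)–(3.108) pp.414–416 + Thm 3.3 p.399 + (3.46) p.398 + (3.42) p.397 + p.398 remark after (3.47) + p.413; Balaban1984PropagatorsII, (2.52)–(2.55) p.232 + Lemma 2.1 p.234] -/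
theorem thm33G0L2M_of_conv3107₂ (𝔬 : B9Thm312Whole.Ops g B X Y Z W) (𝔬' : Ops310 g B X Y ι A) (𝔡 : DirOps310 𝔬' P)
    (𝔩 : DirLetters310 𝔬' P)
    (d d₁ : ℕ) (δ α L₀ δ₀ α₁ ρ' N N' NF Cℓ N2 B2' θ2 N3 B3 θ3 NM BM θM C B₂ ρ : ℝ) (κ : Sizes310)
    (S2 S3 SM : ι → Finset g.Site) (U : B.Cfg)
    (hblk : 𝔬.blk = 𝔬'.blk) (hblkY : 𝔬.blkY = 𝔬'.blkY) (hG0 : 𝔬.G0 U = 𝔬'.G U) (hD : 𝔬.D U = 𝔬'.D U)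
    (hDs : 𝔬.Dstar U = 𝔬'.Dstar U)
    (hNF : 0 ≤ NF) (hN2 : 0 ≤ N2) (hB2' : 0 ≤ B2') (hθ2 : 0 ≤ θ2) (hN3 : 0 ≤ N3) (hB3 : 0 ≤ B3) (hθ3 : 0 ≤ θ3)
    (hNM : 0 ≤ NM) (hBM : 0 ≤ BM) (hθM : 0 ≤ θM)
    (hM : 1 ≤ g.M) (hC : 0 ≤ C) (hαδ : 0 ≤ α * δ) (hα2 : 2 * α * δ ≤ δ) (hα₁δ₀ : 0 ≤ α₁ * δ₀)
    (hrate : (1 - 2 * α) * δ ≤ (1 - α₁) * δ₀)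
    (hB1 : C * L₀ ≤ B₂) (hB3' : secondConst d₁ δ₀ α₁ N3 B3 NF θ3 C L₀ * L₀ ≤ B₂)
    (hBM' : mixedConst d₁ δ₀ α₁ NM BM NF θM C L₀ ≤ B₂) (hB4' : twoConst d₁ δ₀ α₁ N2 B2' NF θ2 C L₀ ≤ B₂)
    (hρ : ρ ≤ (1 - 3 * α) * δ)
    (hs : StaticOK310 𝔬' ρ' N N' NF Cℓ κ)
    (hcnt2 : ∀ a : g.Site, (∑ i, if a ∈ S2 i then (1 : ℝ) else 0) ≤ N2)
    (hcnt3 : ∀ a : g.Site, (∑ i, if a ∈ S3 i then (1 : ℝ) else 0) ≤ N3)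
    (hcntM : ∀ a : g.Site, (∑ i, if a ∈ SM i then (1 : ℝ) else 0) ≤ NM)
    (h261 : Ineq261 d₁ (toB6 g R H) δ₀ α₁) (hF : Facts347 g R H d δ α L₀)
    (hi : Identities310₂ 𝔬' 𝔡 𝔩 R H U)
    (hL2 : L2TwoLegs310 𝔬' R H S2 B2' δ₀ U) (hF2 : FactorsL2_310 𝔬' R H θ2 δ₀ U)
    (hL3 : L2SecondLegs310 𝔬' 𝔡 R H S3 B3 δ₀ U) (hF3 : FactorsL2Second310 𝔬' 𝔡 R H θ3 δ₀ U)
    (hLM : L2MixedLegs310 𝔬' 𝔡 R H SM BM δ₀ U) (hFM : FactorsL2Mixed310 𝔬' 𝔡 R H θM δ₀ U)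
    (hDS : DirSup310 𝔬' 𝔡 R H U) (hDT : DirTranspose310 𝔬' 𝔡 U)
    (hsym : IsTransposePair (𝔬'.G U) (𝔬'.G U)) (htr : IsTransposePair (𝔬'.D U ∘ₗ 𝔬'.G U) (𝔬'.G U ∘ₗ 𝔬'.Dstar U))
    (hc : Conv3107 𝔬' R H C δ U) :
    Thm33G0L2M 𝔬 𝔡.Dd 𝔡.Dsd R H B₂ ρ U := by
  have hL₀ : 0 ≤ L₀ := le_trans (le_trans zero_le_one hF.one_le_L) hF.L_le
  have h4 := l2line4_of_local310_dir 𝔬' 𝔡 𝔩 R H d d₁ δ α L₀ δ₀ α₁ ρ' N N' NF Cℓ N2 B2' θ2 C κ S2 U hNF hN2 hB2' hθ2 hM hC hα2 hα₁δ₀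
    hrate hs hcnt2 h261 hF hi hL2 hF2 hc.2.1 hc.2.2.1 htr
  exact thm33G0L2M_of_conv3107_l4₂ 𝔬 𝔬' 𝔡 𝔩 d d₁ δ α L₀ δ₀ α₁ ρ' N N' NF Cℓ N3 B3 θ3 NM BM θM C
    (twoConst d₁ δ₀ α₁ N2 B2' NF θ2 C L₀) B₂ ρ κ S3 SM U hblk hblkY hG0 hD hDs hNF hN3 hB3 hθ3 hNM hBM hθM hM hC hαδ hα2
    hα₁δ₀ hrate (twoConst_nonneg' hN2 hB2' hNF hθ2 hC hL₀) hB1 hB3' hBM' hB4' hρ hs hcnt3 hcntM h261 hF hi hL3 hF3 hLM hFM hDS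
    hDT hsym htr hc h4

end Assemble

end

end Literature.MathematicalPhysics.QuantumFieldTheory.Balaban1983to89.B9Thm312WholeFromThm310R1A
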